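import Summits.ABC.ABC.Theorems.DefiniteXiFreyModularityCDT
import Summits.ABC.ABC.Theorems.DefiniteXiFreyModularityStubAbsIrrNegThreeGroup
import Literature.NumberTheory.Automorphic.LangWave0Proofs
import Literature.NumberTheory.EllipticCurves.SerreOpenImageSupersingularAssemblyProofs
import Literature.NumberTheory.EllipticCurves.SerreOpenImageOrdinaryInertiaProofs
import Literature.NumberTheory.EllipticCurves.SerreOpenImageTameKummerProofs
import Literature.NumberTheory.EllipticCurves.GlobalMinimalModelProofs
import Literature.NumberTheory.EllipticCurves.IsogenyVariableChangeProofs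
import Literature.NumberTheory.EllipticCurves.CongruentNumberCurveSupersingular
import Literature.NumberTheory.EllipticCurves.SzpiroFreyProofs
import Literature.NumberTheory.EllipticCurves.LFunctionSmulProofs
import Literature.NumberTheory.EllipticCurves.LFunctionPrimeCoeff
import Literature.NumberTheory.DiophantineGeometry.LocalReductionProofs
import HarnessLib

/-!
# Crux `FreyModularity` (stmt-ABC-11340), line `Sketch`: the R3 rigidity stub —
# Frey curves with `3 ∤ abc` have `ρ̄_{E,3}|_{ℚ(√-3)}` absolutely irreducible

The registered stub `isAbsIrreducibleOverSqrt_negThree_freyCurve_of_not_three_dvd` of the line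
`Sketch` of the crux `Summit.ABC.ABC.Theses.DefiniteXi.FreyModularity` ("every Frey curve
`E_(a,b) : y² = x(x - a)(x + b)`, `a ⊥ b`, `ab(a+b) ≠ 0`, is modular").  The line's composition
follows Conrad–Diamond–Taylor 1999, proof of Thm. 7.1.2 (p. 556): **case A** — some framed model
of `E[3]` is absolutely irreducible over `ℚ(√-3)` — is settled by the lifting theorem at `3`
(CDT Thm. 7.2.1).  This file proves that case A contains **every Frey curve with `3 ∤ abc`**,
so that this half of the crux rests on `CDT_theorem_7_2_1` alone
(`isModular_freyCurve_of_CDT_theorem_7_2_1_of_not_three_dvd`):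

* `map_freyIntModel_zmod_three`, `frobeniusTrace_freyIntModel_three` — for `3 ∤ ab(a+b)` the
  residues `{0, a, -b}` are the three elements of `𝔽₃`, the integral Frey model
  `y² = x³ + (b - a)x² - abx` reduces to `y² = x³ - x` (the reduction of the congruent number
  curve `E₁`), which has `4` points: `a₃ = 0`, **good supersingular reduction at `3`**
  (`3 ∤ Δ = 16(ab(a+b))²`; Ireland–Rosen Ch. 18 §4 Thm. 5 via the tree's
  `frobeniusTrace_congruentNumberCurveInt`);
* `frobeniusTrace_three_smul_freyCurve` — the same on a global minimal model `C • E`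
  (`hasGlobalMinimalModel_rat_holds`), through the isomorphism invariance of `L(E, s)`
  (`LFunction_smul`, `LFunction_apply_prime_eq_frobeniusTrace`,
  `lFunction_map_apply_prime_of_not_dvd`);
* `exists_orderOf_eq_eight_of_dvd_frobeniusTrace`, `exists_orderOf_eq_eight_freyCurve` —
  Serre 1972, §1.11, Prop. 12 c) at `p = 3` (`e = 1`): the image of inertia at `3` in
  `Aut(E[3])` is cyclic of order `8 = 3² - 1` (the tree's
  `isCyclic_and_card_inertia_map_of_dvd_frobeniusTrace` with the tame Kummer surjectivity
  `exists_mem_inertia_smul_eq_mul_of_pow_eq`), whence an element of order `8` in the image of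
  any framed model `ρ̄` of `E[3]`;
* the stub — by the group-theoretic criterion of the sibling `…StubAbsIrrNegThreeGroup`
  (`isAbsIrreducibleOverSqrt_negThree_of_orderOf_eq_eight`, with `det ρ̄ = χ̄₃` from the Weil
  pairing, `det_eq_modPCyclotomicCharacter_of_isTorsionGaloisRep_holds`);
* `isModular_freyCurve_of_CDT_theorem_7_2_1_of_not_three_dvd` — the conditional corollary:
  CDT Thm. 7.2.1 (`BCDT.CDT_theorem_7_2_1`, hypothesis) makes every such Frey curve modular
  (`27 ∤ N_E` by `not_nine_dvd_conductorNorm_freyCurve`).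

Nothing is defined; the only unproved named fact is the explicit hypothesis `h721` of the
corollary.

## References

* [ConradDiamondTaylor1999] B. Conrad, F. Diamond, R. Taylor, J. Amer. Math. Soc. 12 (1999),
  Thm. 7.2.1 and the proof of Thm. 7.1.2 (p. 556).
* [Serre1972] J.-P. Serre, Invent. Math. 15 (1972) 259–331, §1.11 Prop. 12 c).
* [IrelandRosen1990] K. Ireland, M. Rosen, *A Classical Introduction to Modern Number Theory*,
  2nd ed. (1990), Ch. 18 §4, Theorem 5.
* [SilvermanAEC2009] J. H. Silverman, *The Arithmetic of Elliptic Curves*, 2nd ed. (2009),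
  Exercise 8.19(a), Prop. VII.1.3(b), Prop. VII.5.1(a).
-/

-- `Summit.<Summit>.<Problem>` is the mandated summit-side namespace (CONVENTIONS §2); for the
-- single-conjunct summit `ABC` the two coincide, so the duplicate `ABC.ABC` is deliberate.
set_option linter.dupNamespace false

noncomputable section

open scoped MatrixGroups NumberField

open Matrix Field IsDedekindDomain
open Literature.NumberTheory.EllipticCurves
open Literature.NumberTheory.Automorphic
open Literature.NumberTheory.Automorphic.BCDT
open Literature.NumberTheory.GaloisRepresentations
open WeierstrassCurve

namespace Summit.ABC.ABC.Theorems

/-! ## Frey curves with `3 ∤ abc`: good supersingular reduction `y² = x³ - x` at `3` -/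

/-- For `3 ∤ ab(a+b)`: `a ≡ b ≢ 0 (mod 3)`, so `b - a ≡ 0` and `-ab ≡ -a² ≡ -1 (mod 3)`.
[folklore] -/
theorem intCast_sub_eq_zero_of_not_three_dvd {a b : ℤ} (h3 : ¬ (3 : ℤ) ∣ a * b * (a + b)) :
    (b : ZMod 3) - a = 0 ∧ -((a : ZMod 3) * b) = -1 := by
  have h : (a : ZMod 3) * (b : ZMod 3) * ((a : ZMod 3) + (b : ZMod 3)) ≠ 0 := by
    intro h0
    apply h3
    have h1 : ((a * b * (a + b) : ℤ) : ZMod 3) = 0 := by push_cast; exact h0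
    exact_mod_cast (ZMod.intCast_zmod_eq_zero_iff_dvd _ 3).mp h1
  have key : ∀ x y : ZMod 3, x * y * (x + y) ≠ 0 → y - x = 0 ∧ -(x * y) = -1 := by decide
  exact key _ _ h

/-- **The Frey curve reduces to `y² = x³ - x` modulo `3` when `3 ∤ abc`**: the integral model
`y² = x³ + (b - a) x² - ab x` (`freyIntModel`, Bombieri–Gubler (12.17)) and the integral model
`y² = x³ - x` of the congruent number curve `E₁` (`congruentNumberCurveInt 1`) have the same
reduction modulo `3` (`b - a ≡ 0`, `-ab ≡ -1`). [folklore] -/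
theorem map_freyIntModel_zmod_three {a b : ℤ} (h3 : ¬ (3 : ℤ) ∣ a * b * (a + b)) :
    (freyIntModel a b).map (Int.castRingHom (ZMod 3)) =
      (congruentNumberCurveInt 1).map (Int.castRingHom (ZMod 3)) := by
  obtain ⟨h1, h2⟩ := intCast_sub_eq_zero_of_not_three_dvd h3
  rw [map_congruentNumberCurveInt]
  ext <;> simp [freyIntModel, h1, h2]

/-- **`a₃ = 0` on the integral Frey model when `3 ∤ abc`**: its reduction `y² = x³ - x` modulo
`3` has `3 + 1 = 4` points (Ireland–Rosen Ch. 18 §4 Thm. 5 at `p = 3 ≡ 3 (mod 4)`; the tree's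
`frobeniusTrace_congruentNumberCurveInt`), i.e. the reduction is supersingular.
[cite: IrelandRosen1990, Ch. 18 §4, Theorem 5] -/
theorem frobeniusTrace_freyIntModel_three {a b : ℤ} (h3 : ¬ (3 : ℤ) ∣ a * b * (a + b)) :
    Literature.NumberTheory.Automorphic.frobeniusTrace (freyIntModel a b) 3 = 0 := by
  have h := frobeniusTrace_congruentNumberCurveInt Nat.prime_three (by norm_num) (n := 1)
    (by norm_num)
  unfold Literature.NumberTheory.Automorphic.frobeniusTrace
    Literature.NumberTheory.Automorphic.numPointsMod at h ⊢
  rwa [map_freyIntModel_zmod_three h3]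

/-- `3 ∤ Δ = 16 (ab(a+b))²` for the integral Frey model when `3 ∤ abc`. [folklore] -/
theorem not_three_dvd_freyIntModel_Δ {a b : ℤ} (h3 : ¬ (3 : ℤ) ∣ a * b * (a + b)) :
    ¬ (3 : ℤ) ∣ (freyIntModel a b).Δ := by
  rw [freyIntModel_Δ]
  intro h
  rcases Int.prime_three.dvd_or_dvd h with h16 | hsq
  · norm_num at h16
  · exact h3 (Int.prime_three.dvd_of_dvd_pow hsq)

/-- The integral Frey model base-changes to the Frey curve: `freyIntModel a b ⊗ ℚ = E_(a,b)`
(the tree's `baseChange_freyIntModel`, along `Int.castRingHom ℚ`). [folklore] -/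
theorem map_freyIntModel_intCastRingHom (a b : ℤ) :
    (freyIntModel a b).map (Int.castRingHom ℚ) = freyCurve a b := by
  ext <;> simp [freyIntModel, freyCurve]

/-- **`a₃(E_(a,b)) = 0` for `3 ∤ abc`**: the third Dirichlet coefficient of `L(E_(a,b), s)`
vanishes — `3 ∤ Δ` of the integral Frey model, so the coefficient is `3 + 1 - #Ẽ(𝔽₃)` computed
on that model (`lFunction_map_apply_prime_of_not_dvd`, Silverman Ex. 8.19(a)), and
`#Ẽ(𝔽₃) = 4` (`frobeniusTrace_freyIntModel_three`). [cite: SilvermanAEC2009, Exercise 8.19(a)] -/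
theorem lFunction_freyCurve_three {a b : ℤ} (h3 : ¬ (3 : ℤ) ∣ a * b * (a + b)) :
    (freyCurve a b).LFunction 3 = 0 := by
  rw [← map_freyIntModel_intCastRingHom,
    lFunction_map_apply_prime_of_not_dvd _ Nat.prime_three
      (by exact_mod_cast not_three_dvd_freyIntModel_Δ h3),
    frobeniusTrace_freyIntModel_three h3]

/-- **The Frey curve has good reduction at the place over `3` when `3 ∤ abc`** (its integral
model has `3 ∤ Δ`; `hasGoodReductionAt_map_of_not_dvd`, Silverman VII.5.1(a)).
[cite: SilvermanAEC2009, Prop. VII.5.1(a)] -/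
theorem hasGoodReductionAt_freyCurve_three {a b : ℤ} (h3 : ¬ (3 : ℤ) ∣ a * b * (a + b))
    {v : HeightOneSpectrum (𝓞 ℚ)} (hv : (Rat.HeightOneSpectrum.primesEquiv v : ℕ) = 3) :
    (freyCurve a b).HasGoodReductionAt v := by
  rw [← map_freyIntModel_intCastRingHom]
  refine hasGoodReductionAt_map_of_not_dvd (freyIntModel a b) v ?_
  rw [hv]
  exact_mod_cast not_three_dvd_freyIntModel_Δ h3

/-- **Good supersingular reduction at `3` on a global minimal model of the Frey curve.**  For
`ab(a+b) ≠ 0`, `3 ∤ abc` and a global minimal model `C • E_(a,b)` (`hasGlobalMinimalModel_rat`):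
`C • E` has good reduction at `3` (good reduction is an isomorphism invariant,
`hasGoodReductionAt_smul_iff_holds`) and its trace of Frobenius `a₃ = 3 + 1 - #Ẽ(𝔽₃)`
(`WeierstrassCurve.frobeniusTrace`, on the global minimal model) vanishes: it is the third
coefficient of `L(C • E, s) = L(E, s)` (`LFunction_apply_prime_eq_frobeniusTrace`,
`LFunction_smul`), which is `0` (`lFunction_freyCurve_three`).
[cite: SilvermanAEC2009, Exercise 8.19(a) and Prop. VII.1.3(b)] -/
theorem frobeniusTrace_three_smul_freyCurve {a b : ℤ} (h0 : a * b * (a + b) ≠ 0)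
    (h3 : ¬ (3 : ℤ) ∣ a * b * (a + b)) (C : VariableChange ℚ)
    [(C • freyCurve a b).IsGloballyMinimal] :
    (C • freyCurve a b).HasGoodReductionAtPrime 3 ∧ (C • freyCurve a b).frobeniusTrace 3 = 0 := by
  haveI := isElliptic_freyCurve h0
  set v : HeightOneSpectrum (𝓞 ℚ) :=
    (Rat.HeightOneSpectrum.primesEquiv (R := 𝓞 ℚ)).symm ⟨3, Nat.prime_three⟩ with hv
  have hv3 : (Rat.HeightOneSpectrum.primesEquiv v : ℕ) = 3 := by
    rw [hv, Equiv.apply_symm_apply]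
  have hgood : (C • freyCurve a b).HasGoodReductionAtPrime 3 := by
    rw [hasGoodReductionAtPrime_primesEquiv_iff_holds (C • freyCurve a b) v 3 hv3,
      hasGoodReductionAt_smul_iff_holds v (freyCurve a b) C]
    exact hasGoodReductionAt_freyCurve_three h3 hv3
  refine ⟨hgood, ?_⟩
  have h := LFunction_apply_prime_eq_frobeniusTrace (C • freyCurve a b) 3 hgood
  rw [LFunction_smul, lFunction_freyCurve_three h3] at h
  exact h.symm

/-! ## Serre's Prop. 12 at `3`: an element of order `8` -/

/-- **A framed model of `E[n]` is a framed model of `E'[n]` for a bijective isogeny `E → E'`**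
(in particular for the substitution isomorphism `E ≅ C • E`): the `Γ_K`-isomorphism
`E[n] ≅ E'[n]` composed with the frame.  A private copy of
`isTorsionGaloisRep_of_isogeny_bijective` (`…StubAbsIrrSqrtFiveLocal`), kept here to keep the
import closure light. [folklore] -/
private theorem isTorsionGaloisRep_of_isogeny_bijective' {K : Type*} [Field K]
    {W W' : WeierstrassCurve K} (κ : Isogeny W W') (hκ : Function.Bijective κ) {n : ℕ}
    {ρ : FramedGaloisRep K (ZMod n) 2} (h : W.IsTorsionGaloisRep n ρ) :
    W'.IsTorsionGaloisRep n ρ := by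
  -- adapted from `Summit.ABC.ABC.Theorems.isTorsionGaloisRep_of_isogeny_bijective`
  have hmem : ∀ P : geomTorsion W n, κ (P : W.geomPoints) ∈ geomTorsion W' n := fun P ↦ by
    have hP : (n : ℤ) • (P : W.geomPoints) = 0 := (Submodule.mem_torsionBy_iff (n : ℤ) _).mp P.2
    refine (Submodule.mem_torsionBy_iff (n : ℤ) _).mpr ?_
    rw [← map_zsmul, hP, map_zero]
  let f : geomTorsion W n → geomTorsion W' n := fun P ↦ ⟨κ (P : W.geomPoints), hmem P⟩
  have hf : Function.Bijective f := by
    constructor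
    · intro P Q hPQ
      exact Subtype.ext (hκ.1 (congrArg Subtype.val hPQ))
    · intro Q
      obtain ⟨P, hP⟩ := hκ.2 (Q : W'.geomPoints)
      have hPn : P ∈ geomTorsion W n := by
        refine (Submodule.mem_torsionBy_iff (n : ℤ) _).mpr (hκ.1 ?_)
        have hQ : (n : ℤ) • (Q : W'.geomPoints) = 0 :=
          (Submodule.mem_torsionBy_iff (n : ℤ) _).mp Q.2
        rw [map_zsmul, hP, hQ, map_zero]
      exact ⟨⟨P, hPn⟩, Subtype.ext hP⟩
  let f' : geomTorsion W n →+ geomTorsion W' n :=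
    { toFun := f
      map_zero' := Subtype.ext (map_zero κ)
      map_add' := fun P Q ↦ Subtype.ext (map_add κ (P : W.geomPoints) (Q : W.geomPoints)) }
  let ε : geomTorsion W n ≃+ geomTorsion W' n := AddEquiv.ofBijective f' hf
  have hε : ∀ P : geomTorsion W n,
      ((ε P : geomTorsion W' n) : W'.geomPoints) = κ (P : W.geomPoints) := fun P ↦ rfl
  have hεsmul : ∀ (σ : absoluteGaloisGroup K) (P : geomTorsion W n), ε (σ • P) = σ • ε P := by
    intro σ P
    apply Subtype.ext
    rw [hε, AddSubgroup.torsionBy.coe_smul, κ.map_smul, AddSubgroup.torsionBy.coe_smul, hε]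
  obtain ⟨e, he⟩ := h
  refine ⟨ε.symm.trans e, fun σ Q ↦ ?_⟩
  have hQ : ε.symm (σ • Q) = σ • ε.symm Q := by
    apply ε.injective
    rw [AddEquiv.apply_symm_apply, hεsmul, AddEquiv.apply_symm_apply]
  rw [AddEquiv.trans_apply, AddEquiv.trans_apply, hQ, he]

/-- **Good supersingular reduction at `3`: the image of `ρ̄_{E,3}` contains an element of order
`8`** (Serre 1972, §1.11, Prop. 12 c) with `e = 1`, `p = 3`).  For `E/ℚ` globally minimal with
`3 ∤ Δ_E`, `3 ∣ a₃(E)` and a framed model `ρ̄` of `E[3]`, the image of an inertia group at `3`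
in `Aut(E[3])` is cyclic of order `8 = 3² - 1` (a non-split Cartan subgroup;
`isCyclic_and_card_inertia_map_of_dvd_frobeniusTrace`, from the surjectivity of the tame Kummer
character `exists_mem_inertia_smul_eq_mul_of_pow_eq`), and a generator maps to an element of
order `8` of `GL₂(𝔽₃)`. [cite: Serre1972, §1.11 Prop. 12 c)] -/
theorem exists_orderOf_eq_eight_of_dvd_frobeniusTrace (W : WeierstrassCurve ℚ)
    [W.IsGloballyMinimal] [W.IsElliptic] (hΔ : ¬ ((3 : ℕ) : ℤ) ∣ minimalDiscriminantInt W)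
    (hss : ((3 : ℕ) : ℤ) ∣ W.frobeniusTrace 3) {ρ : ModPGaloisRep ℚ (ZMod 3) 2}
    (hρ : W.IsTorsionGaloisRep 3 ρ) : ∃ σ : absoluteGaloisGroup ℚ, orderOf (ρ σ) = 8 := by
  -- adapted from `exists_orderOf_eq_three_of_dvd_frobeniusTrace` (`…StubAbsIrrSqrtFive`)
  classical
  set v : HeightOneSpectrum (𝓞 ℚ) :=
    (Rat.HeightOneSpectrum.primesEquiv (R := 𝓞 ℚ)).symm ⟨3, Nat.prime_three⟩ with hv
  have hv3 : (Rat.HeightOneSpectrum.primesEquiv v : ℕ) = 3 := by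
    rw [hv, Equiv.apply_symm_apply]
  obtain ⟨𝔓, hmem, h𝔓⟩ := exists_ideal_placeOver 3 hv3
  have hT : ∀ π ζ : AlgebraicClosure ℚ, π ^ (3 ^ 2 - 1) = ((3 : ℕ) : AlgebraicClosure ℚ) →
      ζ ^ (3 ^ 2 - 1) = 1 → ∃ s ∈ 𝔓.inertia (absoluteGaloisGroup ℚ), s • π = ζ * π :=
    fun π ζ hπ hζ ↦ exists_mem_inertia_smul_eq_mul_of_pow_eq 3 (by norm_num) hv3 h𝔓 hπ hζ
  obtain ⟨hcyc, hcard⟩ :=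
    isCyclic_and_card_inertia_map_of_dvd_frobeniusTrace 3 hΔ hss (by norm_num) hmem hT
  haveI := hcyc
  obtain ⟨z, hz⟩ := IsCyclic.exists_ofOrder_eq_natCard
    (α := (𝔓.inertia (absoluteGaloisGroup ℚ)).map (galoisRepTorsion W ((3 : ℕ) : ℤ)))
  rw [hcard] at hz
  obtain ⟨σ, -, hσ⟩ := Subgroup.mem_map.mp z.2
  have hordσ : orderOf (galoisRepTorsion W ((3 : ℕ) : ℤ) σ) = 8 := by
    rw [hσ, Subgroup.orderOf_coe, hz]; norm_num
  refine ⟨σ, ?_⟩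
  rw [← hordσ]
  refine orderOf_eq_orderOf_iff.mpr fun n ↦ ?_
  rw [← map_pow, ← map_pow, galoisRepTorsion_eq_one_iff']
  -- both sides say: `σⁿ` fixes `E[3]` pointwise
  refine ⟨fun h1 P ↦ ?_, eq_one_of_forall_smul_eq hρ⟩
  obtain ⟨e, he⟩ := hρ
  have h2 := he (σ ^ n) P
  rw [h1, Units.val_one, one_mulVec] at h2
  exact e.injective h2

/-- **R3, arithmetic half: for a Frey curve with `3 ∤ abc` the image of `ρ̄_{E,3}` contains an
element of order `8`.**  `E = E_(a,b)` has good reduction at `3` with `a₃(E) = 0`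
(supersingular: `y² = x³ - x` over `𝔽₃` has `4` points); read on a global minimal model `C • E`
(`hasGlobalMinimalModel_rat_holds`; same `3`-torsion Galois module, same `L`-function:
`frobeniusTrace_three_smul_freyCurve`), Serre's Prop. 12 c) at `3`
(`exists_orderOf_eq_eight_of_dvd_frobeniusTrace`) gives an inertia element acting on `E[3]`
with order `8`. [cite: Serre1972, §1.11 Prop. 12 c)] -/
theorem exists_orderOf_eq_eight_freyCurve {a b : ℤ} (h0 : a * b * (a + b) ≠ 0)
    (h3 : ¬ (3 : ℤ) ∣ a * b * (a + b)) {ρ : ModPGaloisRep ℚ (ZMod 3) 2}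
    (hρ : (freyCurve a b).IsTorsionGaloisRep 3 ρ) :
    ∃ σ : absoluteGaloisGroup ℚ, orderOf (ρ σ) = 8 := by
  haveI := isElliptic_freyCurve h0
  obtain ⟨C, hC⟩ := hasGlobalMinimalModel_rat_holds (freyCurve a b)
  haveI := hC
  obtain ⟨hgood, htr⟩ := frobeniusTrace_three_smul_freyCurve h0 h3 C
  have hΔ :=
    (C • freyCurve a b).not_dvd_minimalDiscriminantInt_of_hasGoodReductionAtPrime' 3 hgood
  have hρ' : (C • freyCurve a b).IsTorsionGaloisRep 3 ρ :=
    isTorsionGaloisRep_of_isogeny_bijective' (VariableChange.toIsogeny (freyCurve a b) C)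
      ⟨VariableChange.toIsogeny_injective (freyCurve a b) C,
        VariableChange.toIsogeny_surjective (freyCurve a b) C⟩ hρ
  have hss : ((3 : ℕ) : ℤ) ∣ (C • freyCurve a b).frobeniusTrace 3 := by
    rw [htr]; exact dvd_zero _
  exact exists_orderOf_eq_eight_of_dvd_frobeniusTrace (C • freyCurve a b) hΔ hss hρ'

/-! ## The stub and its corollary -/

/-- **R3 rigidity — registered stub `isAbsIrreducibleOverSqrt_negThree_freyCurve_of_not_three_dvd`
of the line `Sketch` of the crux `FreyModularity`: for every Frey curve `E_(a,b)`
(`a ⊥ b`, `ab(a+b) ≠ 0`) with `3 ∤ abc` and every framed model `ρ̄` of `E[3]`,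
`ρ̄|_{ℚ(√-3)}` is absolutely irreducible** — so case A of the composition (Conrad–Diamond–Taylor
1999, proof of Thm. 7.1.2, p. 556: the lifting theorem at `3`) covers all these curves.  Proof:
`{0, a, -b}` are the three elements of `𝔽₃`, so `E` has good supersingular reduction
`y² = x³ - x` at `3` and the image of inertia at `3` is a non-split Cartan subgroup of
`GL₂(𝔽₃)`, cyclic of order `8` (Serre 1972, Prop. 12; `exists_orderOf_eq_eight_freyCurve`);
with `det ρ̄ = χ̄₃` (Weil pairing, `det_eq_modPCyclotomicCharacter_of_isTorsionGaloisRep_holds`)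
an element of order `8` forces absolute irreducibility on `Γ_{ℚ(√-3)} = ker χ̄₃`
(`isAbsIrreducibleOverSqrt_negThree_of_orderOf_eq_eight`).
[cite: ConradDiamondTaylor1999, Thm. 7.1.2 (proof, p. 556)] [cite: Serre1972, §1.11 Prop. 12 c)] -/
theorem isAbsIrreducibleOverSqrt_negThree_freyCurve_of_not_three_dvd :
    ∀ a b : ℤ, IsCoprime a b → a * b * (a + b) ≠ 0 → ¬ (3 : ℤ) ∣ a * b * (a + b) →
      ∀ ρ : ModPGaloisRep ℚ (ZMod 3) 2, (freyCurve a b).IsTorsionGaloisRep 3 ρ →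
        ρ.IsAbsIrreducibleOverSqrt (-3) := by
  intro a b _ h0 h3 ρ hρ
  haveI := isElliptic_freyCurve h0
  have hdet := (freyCurve a b).det_eq_modPCyclotomicCharacter_of_isTorsionGaloisRep_holds 3 ρ hρ
  obtain ⟨σ, hσ⟩ := exists_orderOf_eq_eight_freyCurve h0 h3 hρ
  exact isAbsIrreducibleOverSqrt_negThree_of_orderOf_eq_eight ρ hdet hσ

/-- **Case A for Frey curves with `3 ∤ abc`, on the trust base `{CDT_theorem_7_2_1}` alone.**
Granted Conrad–Diamond–Taylor 1999, Thm. 7.2.1 (`BCDT.CDT_theorem_7_2_1`: `E/ℚ` with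
`ρ̄_{E,3}|_{ℚ(√-3)}` absolutely irreducible and `27 ∤ N_E` is modular), every Frey curve
`E_(a,b)` (`a ⊥ b`, `ab(a+b) ≠ 0`) with `3 ∤ abc` is modular: take any framed model `ρ̄` of
`E[3]` (`exists_isTorsionGaloisRep`), absolutely irreducible over `ℚ(√-3)` by the stub
`isAbsIrreducibleOverSqrt_negThree_freyCurve_of_not_three_dvd`, and `27 ∤ N_E` since even
`9 ∤ N_E` (`not_nine_dvd_conductorNorm_freyCurve`).  Same pattern as
`isModular_freyCurve_of_CDT_theorem_7_1_2`. [cite: ConradDiamondTaylor1999, Thm. 7.2.1] -/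
theorem isModular_freyCurve_of_CDT_theorem_7_2_1_of_not_three_dvd (h721 : CDT_theorem_7_2_1)
    {a b : ℤ} (hab : IsCoprime a b) (h0 : a * b * (a + b) ≠ 0) (h3 : ¬ (3 : ℤ) ∣ a * b * (a + b))
    [NeZero ((freyCurve a b).conductorNorm ℤ)] : IsModular (freyCurve a b) := by
  haveI := isElliptic_freyCurve h0
  obtain ⟨ρ, hρ⟩ := (freyCurve a b).exists_isTorsionGaloisRep 3
  exact h721 (freyCurve a b) ρ hρ
    (isAbsIrreducibleOverSqrt_negThree_freyCurve_of_not_three_dvd a b hab h0 h3 ρ hρ) fun h27 ↦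
      not_nine_dvd_conductorNorm_freyCurve hab h0 ((show (9 : ℕ) ∣ 27 by norm_num).trans h27)

end Summit.ABC.ABC.Theorems

end
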